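/-
Copyright (c) 2026 the pub-hodgecm-mathlib formalisation cell (harness21).  Prover seat hodgecm-mathlib-K2Liu-p09 (g8), Track B «K2-LIT» ∕ hLiu418
#184♮, Road I v3, unit U5 «THE CLOSE», FACE-G letter L2 (G-Θ), organ (W-orb), road (C2) of RULING M-158y: the SET-vs-SPAN seam between (C2-i) and (C2-B)
(box K2E5-r02 (g6) 23:49:34Z «JOINT GUARD: one S glue lemma + ℂ-linearity»).  THEOREMS ONLY.  2026-09-04.
-/
import Summits.HodgeConjecture.HodgeConjecture.Theorems.K2LiuArchOrbitDerivClosure       -- ★ p863244 (C2-org): `thetaOrbitLetter_of_dense`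
import HarnessLib

/-!
# K2_Liu road (hLiu418 = stmt-HodgeConjecture-24832), Road I v3, FACE-G letter L2 (G-Θ), organ (W-orb), road (C2): THE SPAN GLUE
# «law on a set `P` of vectors ⇒ law on `span ℂ P`» and the (W-orb) letter from `Dense (span ℂ P)`

Cell `pub/hodgecm-mathlib` (D-0151), Track B, build stream 29; helper lane, count-neutral.  Under RULING M-158y the (W-orb) letter is paid by ★ (C2-org)
`K2LiuArchOrbitDerivClosure.thetaOrbitLetter_of_dense (D) (hD : Dense D) (A) (hlaw : law on D) (horb)`.  The density payer (C2-i) (LH4-p18 (g3),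
`K2LiuArchSchwartzPlaceProductDense`) delivers `Dense ↑(span ℂ P)` for the SET `P` of full place-products (the bare set is not dense), while the derivative
payer (C2-B) (LH4-p05 (g10)) proves the law on the PRODUCTS `d ∈ P` with ONE all-variables operator `A`.  THIS FILE is the seam (box K2E5-r02 (g6)
23:49:34Z): the law extends from `P` to `span ℂ P` by `Submodule.span_induction`, the `smul` step reading `T (U s (c • d)) = (T ∘ (c • ·)) (U s d)` with
`T ∘ (c • ·)` again a continuous REAL-linear functional — which needs `U s` and `A` to be `ℂ`-LINEAR (true: `ω_∞(u)` is a `ℂ`-linear operator of the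
representation ★ `archWeilRep`, and (C2-B)'s `A` is to be stated as a `ℂ`-linear CLM).

* §1 **`hasDerivAt_orbit_span`** (abstract `E`: an `ℝ`- and `ℂ`-module with `IsScalarTower ℝ ℂ E`, continuous `ℂ`-scalar action) — for `ℂ`-linear `U s`, `A`:
  `(hlaw : ∀ d ∈ P, ∀ T, HasDerivAt (s ↦ T (U s d)) (T (A d)) 0) (hd : d ∈ span ℂ P) : ∀ T, HasDerivAt (s ↦ T (U s d)) (T (A d)) 0`.
* §2 **`thetaOrbitLetter_of_dense_span (hX) (P) (hP : Dense ↑(span ℂ P)) (A : 𝓢(X_∞) →L[ℂ] 𝓢(X_∞)) (hlaw : law on P) (horb) : ‹hWorb›`** — ★ `thetaOrbitLetter_of_dense`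
  at `D := ↑(span ℂ P)` and `A.restrictScalars ℝ`, with §1 (`map_smul` of `ω_∞(u)`).  Its three hypotheses are, BY NAME, (C2-i)'s `Dense ↑(span ℂ P)`,
  (C2-B)'s product law with the `ℂ`-linear CLM `A`, and (C2-iii′)'s orbit continuity; its conclusion is the `hWorb` binder of ★ p863031
  `K2LiuFaceGThetaLetter.faceG_thetaLetter_of_archOrbitDeriv` VERBATIM.

No definition, no instance, no notation, no named-fact hypothesis, no `sorry`; axioms ⊆ {propext, Classical.choice, Quot.sound}.  HONEST LABEL: HC_CM is proved only
modulo the 7 printed citations (2 remaining named inputs: hLiu418 = stmt-HodgeConjecture-24832, h413 = stmt-HodgeConjecture-24833) until rung 0 closes; this file is a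
`--supports stmt-HodgeConjecture-24832` helper and moves no counter.

References: [Rudin1991] W. Rudin, Functional Analysis, Thm. 2.6, Thm. 7.17; [Folland1989] G. B. Folland, Harmonic Analysis in Phase Space, §4.2 Prop. (4.39);
[Weil1964] A. Weil, Acta Math. 111 (1964) Chap. III n° 39 p. 189, n° 41 Thm 6 p. 193.
-/

set_option autoImplicit false
set_option linter.dupNamespace false
-- statements over the adelic dual-pair carriers (§2) elaborate to very large types; elaborate sequentially (as in ★ F3)
set_option Elab.async false

noncomputable section

open Filter Set Topology
open scoped SchwartzMap

namespace Summit.HodgeConjecture.HodgeConjecture.Cruxes.HLiu418.K2LiuArchOrbitDerivClosure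

/-! ## §1 The span glue: the weak derivative law extends from a set of vectors to its `ℂ`-span -/

/-- **LAW ON `P` ⇒ LAW ON `span ℂ P`.**  For `ℂ`-linear operators `U s`, `A` of `E` and a set `P` of vectors at which the weak derivative law at `0` holds against
every continuous REAL-linear functional with derivative `A d`, the law holds on the whole `ℂ`-span (`Submodule.span_induction`; the `smul` step tests against
`T ∘ (c • ·)`). [cite: Rudin1991, Thm. 7.17] [cite: Folland1989, §4.2 Prop. (4.39)] -/
theorem hasDerivAt_orbit_span {E F : Type*} [AddCommGroup E] [Module ℝ E] [Module ℂ E] [IsScalarTower ℝ ℂ E]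
    [TopologicalSpace E] [ContinuousConstSMul ℂ E] [NormedAddCommGroup F] [NormedSpace ℝ F]
    (U : ℝ → E →ₗ[ℂ] E) (A : E →ₗ[ℂ] E) (P : Set E)
    (hlaw : ∀ d ∈ P, ∀ T : E →L[ℝ] F, HasDerivAt (fun s : ℝ => T (U s d)) (T (A d)) 0)
    {d : E} (hd : d ∈ Submodule.span ℂ P) :
    ∀ T : E →L[ℝ] F, HasDerivAt (fun s : ℝ => T (U s d)) (T (A d)) 0 := by
  induction hd using Submodule.span_induction with
  | mem x hx => exact hlaw x hx
  | zero =>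
    intro T
    simp only [map_zero]
    exact hasDerivAt_const (0 : ℝ) (0 : F)
  | add x y _ _ hx hy =>
    intro T
    simp only [map_add]
    exact (hx T).add (hy T)
  | smul c x _ hx =>
    intro T
    -- the continuous real-linear map `y ↦ c • y`
    let Sc : E →L[ℝ] E := ⟨(c • (LinearMap.id : E →ₗ[ℂ] E)).restrictScalars ℝ, by exact continuous_const_smul c⟩
    have hSc : ∀ y : E, Sc y = c • y := fun _ => rfl
    have h := hx (T.comp Sc)
    simp only [ContinuousLinearMap.comp_apply, hSc] at h
    simp only [map_smul]
    exact h

end Summit.HodgeConjecture.HodgeConjecture.Cruxes.HLiu418.K2LiuArchOrbitDerivClosure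

/-! ## §2 The (W-orb) letter from `Dense (span ℂ P)`, the product law with a `ℂ`-linear operator, and orbit continuity -/

namespace Summit.HodgeConjecture.HodgeConjecture.Cruxes.HLiu418.K2LiuArchOrbitDerivClosure

open NumberField NumberField.mixedEmbedding MeasureTheory IsDedekindDomain
open scoped Matrix TensorProduct Classical
open Literature.NumberTheory.Automorphic Literature.NumberTheory.Automorphic.UnitaryGroup
open Literature.NumberTheory.Automorphic.IdeleClassGroup
open Literature.NumberTheory.Automorphic.Liu2021
open Literature.NumberTheory.Automorphic.Liu2021.Def411WeilCarriers
open Literature.NumberTheory.Automorphic.Liu2021.Def411WeilCarriersDoubling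
open Literature.NumberTheory.GelbartRogawski1991 Literature.NumberTheory.GelbartRogawski1991.UnitaryDualPair
open Literature.NumberTheory.GelbartRogawski1991.GRConstruction
open Literature.NumberTheory.GaloisRepresentations
open Literature.NumberTheory.Weil1964
open Literature.RepresentationTheory.Liu2021
open Literature.RepresentationTheory.HeisenbergGroup
open Literature.NumberTheory.K2Lit.DoubledLineTheta Literature.NumberTheory.K2Lit.SiegelDoubled
open Summit.HodgeConjecture.HodgeConjecture.Cruxes.HLiu418.K2LiuFaceGThetaLetter (proj_chiSplittingLine_eq_toSp archSkew_diagonal_of_hermD)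
open HodgeCM.Model.HypCensus (archWeilRep continuous_archWeilRep)

variable (L : Type) [Field L] [NumberField L] [IsCMField L]
variable {N n : ℕ} (e : Fin N × Fin 1 ≃ Fin n)
  (dV : Fin N → L) (hdV : ∀ i, IsCMField.complexConj L (dV i) = dV i)
  (dW : Fin 1 → L) (hdW : ∀ i, IsCMField.complexConj L (dW i) = dW i)
  {n'' : ℕ} (e₁ : Fin (n + n) × Fin 1 ≃ Fin n'')
  (hdV0 : ∀ i, dV i ≠ 0) (hdW0 : ∀ i, dW i ≠ 0)
  (lam : IdeleClassGroup L →ₜ* Circle) (hlam : IsConjugateSymplectic L lam) (a' : (Fp L)ˣ)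

/-- **(W-orb) FROM (C2-i) + (C2-B) + (C2-iii′) BY NAME.**  For the small pair's archimedean Weil representation `ω_∞ = archWeilRep … (chiSplittingLine …) hs`
and an arch letter `X`: if the `ℂ`-span of a set `P ⊆ 𝓢(X_∞)` is dense ((C2-i)), `A` is a continuous `ℂ`-LINEAR operator of `𝓢(X_∞)` with the weak derivative law
`∀ d ∈ P, ∀ T, HasDerivAt (t ↦ T (ω_∞(exp tX, 1) d)) (T (A d)) 0` on the set `P` ((C2-B)), and the orbits `t ↦ ω_∞(exp tX, 1) Ψ` are continuous into `𝓢(X_∞)`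
((C2-iii′)), then the `hWorb` letter of ★ `faceG_thetaLetter_of_archOrbitDeriv` holds at EVERY `Ψ_∞` (§1 glue with the `ℂ`-linearity of `ω_∞(u)`, then ★
`thetaOrbitLetter_of_dense` at `D := span ℂ P`). [cite: Folland1989, §4.2 Prop. (4.39)] [cite: Rudin1991, Thm. 2.6, Thm. 7.17] [cite: Weil1964, Chap. III n° 39 p. 189] -/
theorem thetaOrbitLetter_of_dense_span {X : Matrix (Fin (n + n)) (Fin (n + n)) (mixedSpace L)}
    (hX : X ∈ archSkew (Fp L) L (IsCMField.complexConj L) (n + n) (hermD L e dV hdV dW hdW))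
    (P : Set 𝓢((Fin n'' → mixedSpace (Fp L)), ℂ))
    (hP : Dense (↑(Submodule.span ℂ P) : Set 𝓢((Fin n'' → mixedSpace (Fp L)), ℂ)))
    (A : 𝓢((Fin n'' → mixedSpace (Fp L)), ℂ) →L[ℂ] 𝓢((Fin n'' → mixedSpace (Fp L)), ℂ))
    (hlaw : ∀ d ∈ P, ∀ T : 𝓢((Fin n'' → mixedSpace (Fp L)), ℂ) →L[ℝ] ℂ,
      HasDerivAt (fun t : ℝ => T
        (archWeilRep (Fp L) L (IsCMField.complexConj L) (n + n) 1 (Matrix.diagonal (dD L e dV hdV dW hdW)) (JW (Fp L) L a')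
            (complexConj_imagUnit L) (imagUnit_ne_zero L) (imagUnit_mul_self L)
            (realDiagonal_isSymm L (dD L e dV hdV dW hdW) (dD_conj L e dV hdV dW hdW)) (isSymm_TW (Fp L) a')
            (isUnit_det_realDiagonal L (dD L e dV hdV dW hdW) (dD_conj L e dV hdV dW hdW) (dD_ne_zero L e dV hdV dW hdW hdV0 hdW0))
            (isUnit_det_TW (Fp L) a') (realDiagonal_map L (dD L e dV hdV dW hdW) (dD_conj L e dV hdV dW hdW)).symm (JW_eq (Fp L) L a') e₁
            (chiSplittingLine L e₁ (dD L e dV hdV dW hdW) (dD_conj L e dV hdV dW hdW) (dD_ne_zero L e dV hdV dW hdW hdV0 hdW0)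
              (toHeckeCharacter L lam) (isUnitary_toHeckeCharacter L lam)
              ((isOscillatorChar_toHeckeCharacter_iff lam).mpr hlam) (TW (Fp L) a')
              (isUnit_det_TW (Fp L) a') (JW (Fp L) L a') (JW_eq (Fp L) L a'))
            (proj_chiSplittingLine_eq_toSp L e dV hdV dW hdW e₁ hdV0 hdW0 lam hlam a')
            (⟨expGL (t • X), expGL_smul_mem_arch (Matrix.diagonal (dD L e dV hdV dW hdW)) (archSkew_diagonal_of_hermD L e dV hdV dW hdW hX) t⟩, 1)
            d))
        (T (A d)) 0)
    (horb : ∀ Ψ : 𝓢((Fin n'' → mixedSpace (Fp L)), ℂ), Continuous fun t : ℝ =>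
        (archWeilRep (Fp L) L (IsCMField.complexConj L) (n + n) 1 (Matrix.diagonal (dD L e dV hdV dW hdW)) (JW (Fp L) L a')
            (complexConj_imagUnit L) (imagUnit_ne_zero L) (imagUnit_mul_self L)
            (realDiagonal_isSymm L (dD L e dV hdV dW hdW) (dD_conj L e dV hdV dW hdW)) (isSymm_TW (Fp L) a')
            (isUnit_det_realDiagonal L (dD L e dV hdV dW hdW) (dD_conj L e dV hdV dW hdW) (dD_ne_zero L e dV hdV dW hdW hdV0 hdW0))
            (isUnit_det_TW (Fp L) a') (realDiagonal_map L (dD L e dV hdV dW hdW) (dD_conj L e dV hdV dW hdW)).symm (JW_eq (Fp L) L a') e₁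
            (chiSplittingLine L e₁ (dD L e dV hdV dW hdW) (dD_conj L e dV hdV dW hdW) (dD_ne_zero L e dV hdV dW hdW hdV0 hdW0)
              (toHeckeCharacter L lam) (isUnitary_toHeckeCharacter L lam)
              ((isOscillatorChar_toHeckeCharacter_iff lam).mpr hlam) (TW (Fp L) a')
              (isUnit_det_TW (Fp L) a') (JW (Fp L) L a') (JW_eq (Fp L) L a'))
            (proj_chiSplittingLine_eq_toSp L e dV hdV dW hdW e₁ hdV0 hdW0 lam hlam a')
            (⟨expGL (t • X), expGL_smul_mem_arch (Matrix.diagonal (dD L e dV hdV dW hdW)) (archSkew_diagonal_of_hermD L e dV hdV dW hdW hX) t⟩, 1)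
            Ψ)) :
    ∀ Ψinf : 𝓢((Fin n'' → mixedSpace (Fp L)), ℂ), ∃ Ψinf' : 𝓢((Fin n'' → mixedSpace (Fp L)), ℂ),
      ∀ T : 𝓢((Fin n'' → mixedSpace (Fp L)), ℂ) →L[ℝ] ℂ,
      HasDerivAt (fun t : ℝ => T
        (archWeilRep (Fp L) L (IsCMField.complexConj L) (n + n) 1 (Matrix.diagonal (dD L e dV hdV dW hdW)) (JW (Fp L) L a')
            (complexConj_imagUnit L) (imagUnit_ne_zero L) (imagUnit_mul_self L)
            (realDiagonal_isSymm L (dD L e dV hdV dW hdW) (dD_conj L e dV hdV dW hdW)) (isSymm_TW (Fp L) a')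
            (isUnit_det_realDiagonal L (dD L e dV hdV dW hdW) (dD_conj L e dV hdV dW hdW) (dD_ne_zero L e dV hdV dW hdW hdV0 hdW0))
            (isUnit_det_TW (Fp L) a') (realDiagonal_map L (dD L e dV hdV dW hdW) (dD_conj L e dV hdV dW hdW)).symm (JW_eq (Fp L) L a') e₁
            (chiSplittingLine L e₁ (dD L e dV hdV dW hdW) (dD_conj L e dV hdV dW hdW) (dD_ne_zero L e dV hdV dW hdW hdV0 hdW0)
              (toHeckeCharacter L lam) (isUnitary_toHeckeCharacter L lam)
              ((isOscillatorChar_toHeckeCharacter_iff lam).mpr hlam) (TW (Fp L) a')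
              (isUnit_det_TW (Fp L) a') (JW (Fp L) L a') (JW_eq (Fp L) L a'))
            (proj_chiSplittingLine_eq_toSp L e dV hdV dW hdW e₁ hdV0 hdW0 lam hlam a')
            (⟨expGL (t • X), expGL_smul_mem_arch (Matrix.diagonal (dD L e dV hdV dW hdW)) (archSkew_diagonal_of_hermD L e dV hdV dW hdW hX) t⟩, 1)
            Ψinf))
        (T Ψinf') 0 :=
  thetaOrbitLetter_of_dense L e dV hdV dW hdW e₁ hdV0 hdW0 lam hlam a' hX (↑(Submodule.span ℂ P)) hP (A.restrictScalars ℝ)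
    (fun _ hd T => hasDerivAt_orbit_span (F := ℂ)
      (fun s : ℝ =>
        (archWeilRep (Fp L) L (IsCMField.complexConj L) (n + n) 1 (Matrix.diagonal (dD L e dV hdV dW hdW)) (JW (Fp L) L a')
            (complexConj_imagUnit L) (imagUnit_ne_zero L) (imagUnit_mul_self L)
            (realDiagonal_isSymm L (dD L e dV hdV dW hdW) (dD_conj L e dV hdV dW hdW)) (isSymm_TW (Fp L) a')
            (isUnit_det_realDiagonal L (dD L e dV hdV dW hdW) (dD_conj L e dV hdV dW hdW) (dD_ne_zero L e dV hdV dW hdW hdV0 hdW0))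
            (isUnit_det_TW (Fp L) a') (realDiagonal_map L (dD L e dV hdV dW hdW) (dD_conj L e dV hdV dW hdW)).symm (JW_eq (Fp L) L a') e₁
            (chiSplittingLine L e₁ (dD L e dV hdV dW hdW) (dD_conj L e dV hdV dW hdW) (dD_ne_zero L e dV hdV dW hdW hdV0 hdW0)
              (toHeckeCharacter L lam) (isUnitary_toHeckeCharacter L lam)
              ((isOscillatorChar_toHeckeCharacter_iff lam).mpr hlam) (TW (Fp L) a')
              (isUnit_det_TW (Fp L) a') (JW (Fp L) L a') (JW_eq (Fp L) L a'))
            (proj_chiSplittingLine_eq_toSp L e dV hdV dW hdW e₁ hdV0 hdW0 lam hlam a')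
            (⟨expGL (s • X), expGL_smul_mem_arch (Matrix.diagonal (dD L e dV hdV dW hdW)) (archSkew_diagonal_of_hermD L e dV hdV dW hdW hX) s⟩, 1)))
      (A : 𝓢((Fin n'' → mixedSpace (Fp L)), ℂ) →ₗ[ℂ] 𝓢((Fin n'' → mixedSpace (Fp L)), ℂ)) P hlaw hd T)
    horb

end Summit.HodgeConjecture.HodgeConjecture.Cruxes.HLiu418.K2LiuArchOrbitDerivClosure

end
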